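import Mathlib
import Summits.NavierStokesRegularity.NavierStokesRegularity.Theses.RootDecompLitSlice
import Summits.NavierStokesRegularity.NavierStokesRegularity.Theorems.RootDecompLitSliceGeneralWindowTradeoffStubEnergyDrop
import Summits.NavierStokesRegularity.NavierStokesRegularity.Theorems.RootDecompLitSliceGeneralWindowTradeoffStubWindowHardy
import HarnessLib

/-!
# Route RootDecompLitSlice — support STg `GeneralWindowTradeoff` CLOSED (stmt-NavierStokesRegularity-27390)

`Summit.NavierStokesRegularity.NavierStokesRegularity.Theses.RootDecompLitSlice.GeneralWindowTradeoff`
— the FREE-WINDOW SCAR–MODULUS TRADE-OFF on the classical Leray–Hopf frame (classical on `[0,T)`,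
Leray–Hopf on `[0,T]`, rapidly decaying datum): if `∫|u(t) − u(T)|² ≤ H` for all `t ∈ [T−τ, T)`
(`0 < r`, `0 < τ < T`, `0 ≤ H`) then
`∫_{B_r(x₀)}|u(T)|² ≤ 2H + (8‖u(0)‖₂/ν)(r²/τ)√H` — follows BY NAME from the two registered stubs of
its skeleton `free_window` (sha256 ab1b91173537), both now kernel theorems:

* (M) `GeneralWindowTradeoff.stub_windowHardyEnergy` (p829508; Hardy on balls + windowed energy
  identity + mean value + `L²(B_r)` triangle):
  `∫_{B_r(x₀)}|u(T)|² ≤ 2H + (4r²/(ντ))·(‖u(T−τ)‖₂² − ‖u(T)‖₂²)`;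
* (S) `GeneralWindowTradeoff.stub_energyDrop_le_modulus` (p829238; Leray–Hopf energy monotonicity +
  `L²` triangle): `‖u(t)‖₂² − ‖u(T)‖₂² ≤ 2‖u(0)‖₂√H`.

The composition below is the skeleton's `GeneralWindowTradeoff_of` VERBATIM (apply (S) at
`t = T − τ` inside the right-hand side of (M); `4·(r²/(ντ))·2‖u₀‖₂√H = (8‖u₀‖₂/ν)(r²/τ)√H`).

HONEST FRAMING: STg is route-internal SUPPORT (rank 9) below ST `ScarModulusTradeoff` ⟨31791⟩
(ST = the parabolic window `τ = r²`, closed in the companion file); it is the engine of the writer g32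
clock→scar law `α(b) = 4b/(b+2)` inside the Tao-vacuous cell Uᶜ and bears on no load of the route
(ROOT ⟺ U ∧ P1; critic rows 354/371/563). Rung 0: nothing here proves NS regularity. Decomp-ns
route-writer g36. [folklore]
-/

set_option linter.dupNamespace false

namespace Summit.NavierStokesRegularity.NavierStokesRegularity.Theorems

open MeasureTheory Set
open scoped ENNReal

/-- **Support STg `GeneralWindowTradeoff` of route RootDecompLitSlice, by name** (free-window
scar–modulus trade-off `∫_{B_r(x₀)}|u(T)|² ≤ 2H + (8‖u(0)‖₂/ν)(r²/τ)√H`): the skeleton composition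
`GeneralWindowTradeoff_of` of `free_window` over the landed stubs (M) `stub_windowHardyEnergy` and (S)
`stub_energyDrop_le_modulus`. Route-internal support; decorative for the summit (D-0179). [folklore] -/
theorem generalWindowTradeoff :
    Summit.NavierStokesRegularity.NavierStokesRegularity.Theses.RootDecompLitSlice.GeneralWindowTradeoff := by
  intro ν T hν hT u p hcl hLH hdec x₀ r τ H hr hτ hτT hH hmod
  -- (1) stub (S): the energy drop over the window is paid by the modulus at its left end `T − τ`
  have hdrop : (∫ x, ‖u (T - τ) x‖ ^ 2) - ∫ x, ‖u T x‖ ^ 2 ≤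
      2 * Real.sqrt (∫ x, ‖u 0 x‖ ^ 2) * Real.sqrt H :=
    GeneralWindowTradeoff.stub_energyDrop_le_modulus ν T hν hT u p hcl hLH hdec (T - τ)
      ⟨by linarith, by linarith⟩ H hH (hmod (T - τ) ⟨le_rfl, by linarith⟩)
  -- (2) stub (M): localized terminal energy ≤ 2H + (4r²/(ντ))·(energy drop)
  have hloc := GeneralWindowTradeoff.stub_windowHardyEnergy ν T hν hT u p hcl hLH hdec x₀ r τ H hr
    hτ hτT hH hmod
  have hcoef : 0 ≤ 4 * (r ^ 2 / (ν * τ)) := by positivity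
  calc ∫ x in Metric.ball x₀ r, ‖u T x‖ ^ 2
      ≤ 2 * H + 4 * (r ^ 2 / (ν * τ)) * ((∫ x, ‖u (T - τ) x‖ ^ 2) - ∫ x, ‖u T x‖ ^ 2) := hloc
    _ ≤ 2 * H + 4 * (r ^ 2 / (ν * τ)) * (2 * Real.sqrt (∫ x, ‖u 0 x‖ ^ 2) * Real.sqrt H) := by
        gcongr
    _ = 2 * H + 8 * Real.sqrt (∫ x, ‖u 0 x‖ ^ 2) / ν * (r ^ 2 / τ) * Real.sqrt H := by
        have hν0 : ν ≠ 0 := hν.ne'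
        have hτ0 : τ ≠ 0 := hτ.ne'
        field_simp
        ring

end Summit.NavierStokesRegularity.NavierStokesRegularity.Theorems
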